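import Literature.NumberTheory.NumberFields.CubicFieldDedekindKummer
import Literature.NumberTheory.NumberFields.IntegralBasisIndex
import HarnessLib

/-!
# Power integral bases, III: index EXACTLY `2` — a half-integral algebraic integer outside `ℤ[θ]` and `Δ(f) = 2²·e`, `e` squarefree, give `d_K = e`
# (Marcus, *Number Fields*, Ch. 2, Exercise 27; Dedekind's common-index-divisor fields)

Sequel of `IntegralBasisCriterion.lean` / `IntegralBasisIndex.lean` for the explicit monic cubics `MonicCubic.poly a b c` (`CubicFieldExplicit.lean`).
The two earlier files decide the MONOGENIC case (`indexDet = ±1`, `d_K = Δ(f)`) and give the inclusion `r · 𝓞 K ⊆ ℤ[θ]` when `Δ(f) = r² e`, `e` squarefree.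
The cubic fields in which `2` splits completely (Dedekind's example type: `2` is a common index divisor, NO generator has odd index) need the case of index
EXACTLY `2`: here we prove it from ONE displayed half-integral element.

* `not_isUnit_indexDet_of_two_mul_eq` — if an algebraic integer `x` has `2x = u + vθ + wθ²` with `u, v, w ∈ ℤ` not all even, the index determinant
  of `1, θ, θ²` is not a unit (else `x ∈ ℤ[θ]`, `x = Q(θ)` with `deg Q ≤ 2` after division by `f`, and `2Q − (u + vX + wX²)` is a polynomial of degree `≤ 2`
  vanishing at `θ`, hence zero — parity contradiction).
* `discr_eq_of_disc_eq_four_mul` — if moreover `Δ(f) = 2²·e` with `e` squarefree then **`d_K = e`** (`indexDet ∣ 2` and is not a unit, so `indexDet² = 4`).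

Everything is proved; theorems only (no definition, no named fact, no instance). Written by the prover seat `bsd-line-att-p4` g46 (cell `bsd-f1-sign2`) for
the split-stratum cubic `2`-torsion fields of route `AlignedTransportAtTwo` (first customer: the cubic field of discriminant `−431`, `f = X³ − X + 8`,
`δ = (θ² + θ)/2`). [cite: Marcus2018, Ch. 2, Exercise 27]

## References
* [Marcus2018] D. A. Marcus, *Number Fields*, 2nd ed. (2018), Ch. 2, Exercise 27 (c)–(e); Ch. 3, Exercise 21 (Dedekind's example of a common index divisor).
-/

noncomputable section

open scoped NumberField
open Module NumberField Polynomial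

namespace Literature.NumberTheory.NumberFields.MonicCubic

variable {K : Type*} [Field K] [NumberField K] {a b c : ℤ} {θ : K}

/-- **A half-integral element detects index `2`.**  If `x ∈ 𝓞 K` satisfies `2x = u + vθ + wθ²` with `u, v, w ∈ ℤ` not all even, then the index
determinant of the power basis `1, θ, θ²` is not a unit (i.e. `𝓞 K ≠ ℤ[θ]`). [cite: Marcus2018, Ch. 2, Exercise 27(d)] -/
theorem not_isUnit_indexDet_of_two_mul_eq (hirr : Irreducible (polyQ a b c)) (hθ : aeval θ (poly a b c) = 0)
    (h3 : finrank ℚ K = 3) (x : 𝓞 K) (u v w : ℤ) (hx : 2 * (x : K) = u + v * θ + w * θ ^ 2)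
    (hodd : ¬ (2 ∣ u ∧ 2 ∣ v ∧ 2 ∣ w)) :
    ¬ IsUnit (indexDet (pb hirr hθ h3) (isIntegral_pb_gen hirr hθ h3)) := by
  intro hunit
  have hmem := mem_adjoin_of_isUnit_indexDet (pb hirr hθ h3) (isIntegral_pb_gen hirr hθ h3) hunit x
  rw [pb_gen, Algebra.adjoin_singleton_eq_range_aeval] at hmem
  obtain ⟨P, hP⟩ := hmem
  -- reduce `P` modulo the monic cubic `f`
  set Q : ℤ[X] := P %ₘ poly a b c with hQdef
  have hQ : aeval θ Q = (x : K) := by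
    rw [hQdef, aeval_modByMonic_eq_self_of_root hθ]
    exact hP
  have hdegQ : Q.natDegree ≤ 2 := by
    have hne : poly a b c ≠ 1 := fun h => by
      have h' := congrArg natDegree h
      rw [natDegree_poly, natDegree_one] at h'
      exact absurd h' (by norm_num)
    have h := natDegree_modByMonic_lt P (monic_poly a b c) hne
    rw [natDegree_poly] at h
    rw [hQdef]; omega
  -- the polynomial `2Q − (u + vX + wX²)` of degree `≤ 2` vanishes at `θ`
  set G : ℤ[X] := C (2 : ℤ) * Q - (C u + C v * X + C w * X ^ 2) with hGdef
  have hG0 : aeval θ G = 0 := by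
    rw [hGdef]
    simp only [map_sub, map_add, map_mul, map_pow, aeval_X, eq_intCast, map_intCast, map_ofNat, hQ]
    linear_combination hx
  have hdegG : G.natDegree ≤ 2 := by
    rw [hGdef]
    refine (natDegree_sub_le _ _).trans (max_le ?_ ?_)
    · exact (natDegree_C_mul_le _ _).trans hdegQ
    · refine (natDegree_add_le _ _).trans (max_le ((natDegree_add_le _ _).trans (max_le ?_ ?_)) ?_)
      · exact (natDegree_C _).le.trans (by norm_num)
      · exact (natDegree_C_mul_le _ _).trans (natDegree_X_le.trans (by norm_num))
      · exact (natDegree_C_mul_le _ _).trans (natDegree_X_pow_le 2)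
  -- hence it is zero: a non-zero rational polynomial of degree `≤ 2` cannot vanish at `θ` of degree `3`
  have hG : G = 0 := by
    by_contra hne
    have hneQ : G.map (Int.castRingHom ℚ) ≠ 0 := by
      rwa [Ne, Polynomial.map_eq_zero_iff (Int.castRingHom ℚ).injective_int]
    have hrootQ : aeval θ (G.map (Int.castRingHom ℚ)) = 0 := by
      rw [show Int.castRingHom ℚ = algebraMap ℤ ℚ from rfl, aeval_map_algebraMap, hG0]
    have hle := minpoly.degree_le_of_ne_zero ℚ θ hneQ hrootQ
    rw [minpoly_rat_eq hirr hθ, degree_eq_natDegree (monic_polyQ a b c).ne_zero, natDegree_polyQ,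
      degree_eq_natDegree hneQ] at hle
    have hdm : (G.map (Int.castRingHom ℚ)).natDegree ≤ 2 := (natDegree_map_le).trans hdegG
    have : (3 : WithBot ℕ) ≤ (2 : ℕ) := hle.trans (by exact_mod_cast hdm)
    exact absurd this (by decide)
  -- compare coefficients: `2·Q_i = u, v, w`
  have h0 := congrArg (fun p : ℤ[X] => p.coeff 0) hG
  have h1 := congrArg (fun p : ℤ[X] => p.coeff 1) hG
  have h2 := congrArg (fun p : ℤ[X] => p.coeff 2) hG
  simp only [hGdef, coeff_sub, coeff_add, coeff_C_mul, coeff_C, coeff_X, coeff_X_pow, coeff_zero] at h0 h1 h2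
  norm_num at h0 h1 h2
  exact hodd ⟨⟨Q.coeff 0, by linarith⟩, ⟨Q.coeff 1, by linarith⟩, ⟨Q.coeff 2, by linarith⟩⟩

/-- **Index exactly `2`: `d_K = e` when `Δ(f) = 2²·e` with `e` squarefree and some algebraic integer is half-integral on `1, θ, θ²`.**  (`indexDet ∣ 2`
by `indexDet_dvd_of_discr_eq_sq_mul`, `indexDet ≠ ±1` by `not_isUnit_indexDet_of_two_mul_eq`, so `indexDet² = 4` in `Δ(f) = indexDet²·d_K`.)
[cite: Marcus2018, Ch. 2, Exercise 27(c)–(e)] -/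
theorem discr_eq_of_disc_eq_four_mul (hirr : Irreducible (polyQ a b c)) (hθ : aeval θ (poly a b c) = 0)
    (h3 : finrank ℚ K = 3) {e : ℤ} (hdisc : disc a b c = 2 ^ 2 * e) (he : Squarefree e)
    (x : 𝓞 K) (u v w : ℤ) (hx : 2 * (x : K) = u + v * θ + w * θ ^ 2) (hodd : ¬ (2 ∣ u ∧ 2 ∣ v ∧ 2 ∣ w)) :
    NumberField.discr K = e := by
  set i := indexDet (pb hirr hθ h3) (isIntegral_pb_gen hirr hθ h3) with hi
  have hsq := discr_powerBasis_eq_indexDet_sq_mul_discr (pb hirr hθ h3) (isIntegral_pb_gen hirr hθ h3)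
  rw [discr_pb, hdisc] at hsq
  have hdvd : i ∣ 2 := indexDet_dvd_of_discr_eq_sq_mul (pb hirr hθ h3) (isIntegral_pb_gen hirr hθ h3) 2 e
    (by rw [discr_pb, hdisc]) he
  have hnu : ¬ IsUnit i := not_isUnit_indexDet_of_two_mul_eq hirr hθ h3 x u v w hx hodd
  have hnat : i.natAbs ∣ 2 := by
    have := Int.natAbs_dvd_natAbs.mpr hdvd
    simpa using this
  have hne1 : i.natAbs ≠ 1 := fun h1 => hnu (Int.isUnit_iff_natAbs_eq.mpr h1)
  have h2 : i.natAbs = 2 := by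
    have hle : i.natAbs ≤ 2 := Nat.le_of_dvd (by norm_num) hnat
    interval_cases h : i.natAbs
    · exact absurd (zero_dvd_iff.mp hnat) (by norm_num)
    · exact absurd rfl hne1
    · rfl
  have hi2 : i ^ 2 = 4 := by
    rw [sq, ← Int.natAbs_mul_self, h2]; norm_num
  have hz : (2 : ℤ) ^ 2 * e = i ^ 2 * NumberField.discr K := by exact_mod_cast hsq
  rw [hi2] at hz
  linarith

end Literature.NumberTheory.NumberFields.MonicCubic

end
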